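import Literature.Computability.AlgebraicComplexity.KoiranPortierTavenas2015.Witness
import Literature.Computability.AlgebraicComplexity.BD17WronskianCriterionProofs
import HarnessLib

/-!
# Koiran–Portier–Tavenas 2015, §2 "Zeros of the Wronskian as an upper bound":
# Lemma 5 (Bôcher), Theorems 7 and 8 (PROVED)

P. Koiran, N. Portier, S. Tavenas, *A Wronskian approach to the real τ-conjecture*, J. Symbolic
Comput. **68**:2 (2015) 195–214 = arXiv:1205.1015 [KoiranPortierTavenas2015]; held text
`paper:arxiv-1205.1015` (corpus-tex, 18 chunks; the numbering "Lemma 3, 4, 5, Def. 6, Thm. 7, 8, 9,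
Thm. 12, Thm. 25" is the one of that text and of the sibling files `Witness.lean` / `AnswerNo.lean`
and of the routes citing this paper). THEOREMS ONLY (0 definitions, 0 named facts): the two upper
bounds of §2 become theorems of the tree, in the vocabulary of the sibling file `Witness.lean`
(`wronskian f m = W(f 0, …, f (m−1))`, `realZeros g = Z_ℝ(g) ∈ ℕ∞`, families indexed by `ℕ` with
only the first `k` entries consumed) and of the Pólya–Szegő kit of `BD17WronskianIdentities.lean` /
`BD17DescartesRuleRootCounting.lean` / `BD17WronskianCriterionProofs.lean` (`BD17.wronskian`,
`BD17.rootCountMult` = roots counted with multiplicity, multiplicity = order of vanishing), on which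
the proofs run. Printed statements (p0005 of the held text):

* **Lemma 3** (p0005:L11): "`W(gf_1,…,gf_k) = g^k W(f_1,…,f_k)`" — `KPT2015_lemma_3_analytic` (=
  Pólya–Szegő VII 57, the tree's `BD17.wronskian_mul_left`).
* **Lemma 4** (p0005:L18): "over an interval `I` where they do not vanish,
  `W(f_1,…,f_k) = (f_1)^k W((f_2/f_1)', …, (f_k/f_1)')`" — `KPT2015_lemma_4_analytic`
  (= Pólya–Szegő VII 58, the tree's `BD17.wronskian_deriv_div_mul_pow`; only `f_1 ≠ 0` is needed).
* **Lemma 5** (p0005:L26, Bôcher): "If `f_1,…,f_k` are analytic functions, then `(f_i)` is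
  linearly dependent if and only if `W(f_1,…,f_k) = 0`" — `KPT2015_lemma_5` (open interval; a
  relation `Σ a_i f_i = 0` with coefficients not all zero ⟺ `W ≡ 0`), its easy half
  `wronskian_eq_zero_of_linear_relation`, and `KPT2015_lemma_5_real` (`I = ℝ`).
* **Def. 6** (p0005:L29): "`Z_I(g)` the number of distinct real roots of `g` over `I`" — rendered
  INLINE as `Set.encard {y | y ∈ I ∧ g y = 0} : ℕ∞` (and, for `I = ℝ`, the sibling file's
  `realZeros g`); no new definition.
* **Theorem 7** (p0005:L36): "Let `k` be a non zero integer. Let `f_i` be `k` functions `k−1` times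
  differentiable in an interval `I` such that for all `i ≤ k`, the Wronskian `W(f_1,…,f_i)` does not
  have any zero over `I`. If the real constants `a_1,…,a_k` are not all equal to `0`,
  `a_1f_1+⋯+a_kf_k` has at most `k−1` real zeros over `I` counted with multiplicity." —
  `KPT2015_thm_7_analytic` (the ANALYTIC special case, with multiplicity = `BD17.rootCountMult`),
  `KPT2015_thm_7_analytic_ncard` (distinct zeros), `KPT2015_thm_7_analytic_real` (`I = ℝ`,
  `realZeros`); the suffix `_analytic` marks the special case of the printed
  `(k−1)`-times-differentiable statement (likewise `KPT2015_lemma_3_analytic`,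
  `KPT2015_lemma_4_analytic`).
* **Theorem 8** (p0005:L62): "Let `f_1,…,f_k` be analytic functions on an interval `I`. If the real
  constants `a_1,…,a_k` are not all equal to `0`,
  `Z(a_1f_1+⋯+a_kf_k) ≤ (1 + Σ_{i=1}^k Z(W(f_1,…,f_i))) k − 1` (Eq1). More precisely, if
  `Υ = {x ∈ I | ∃ i ≤ k, W(f_1,…,f_i)(x) = 0}` is finite, then
  `Z(a_1f_1+⋯+a_kf_k) ≤ (1 + |Υ|) k − 1` (Eq2)." — `KPT2015_thm_8` (Eq2, as printed, `ℕ∞`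
  arithmetic), `KPT2015_thm_8_sum` (Eq1), `KPT2015_thm_8_add_one_le` (Eq2 in the subtraction-free
  form `Z + 1 ≤ (1+|Υ|)k`), `KPT2015_thm_8_real` (`I = ℝ` with `realZeros`, the exact shape of the
  sibling file's REFUTED §6 question `KPTWronskianBoundOnR`, which is (Eq1) WITHOUT the factor `k`).

**Typed-vs-printed (honest scope).** (1) The interval: the paper allows any interval not reduced
to a point (closed or half-open ends, unbounded); typed here for OPEN intervals, rendered as an
open preconnected subset `Δ ⊆ ℝ` (`IsOpen Δ`, `IsPreconnected Δ` — this includes `∅` and `ℝ`,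
harmlessly), which is the case `I = ℝ` of the sibling files and of the route consumers.
`-- TODO(general form): non-open intervals (zeros at a closed endpoint).` (2) Thm. 7 is printed for
`(k−1)`-times differentiable functions; typed for real-ANALYTIC functions
(`AnalyticOnNhd ℝ (f i) Δ`), the setting of Thm. 8 and of §§3–6, in which "counted with
multiplicity" is the order of vanishing (`BD17.rootCountMult`, as in BD 2017 Def. 4.1 /
Pólya–Szegő V 12).
`-- TODO(general form): (k−1)-times differentiable functions in Thm. 7.` (3) "`a_1,…,a_k` not all
`0`" = `∃ i < k, a i ≠ 0` (which forces `k ≥ 1`, the printed "non zero integer `k`"); the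
combination is `y ↦ Σ_{i<k} a i * f i y`; the prefix Wronskians are `wronskian f i`, `1 ≤ i ≤ k`.
(4) The "moreover" clause of Thm. 8 (zeros off `Υ` may be counted with multiplicity) is not typed
separately; it is visible in the proof (`KPT2015_thm_7_analytic` bounds the count WITH multiplicity
on each component of `I ∖ Υ`). Nothing else of the paper is typed here: Thm. 9 (§5, the
refinement `k − 1 + Z(W_k) + Z(W_{k−1}) + 2Σ_{j≤k−2} Z(W_j)` via Frobenius' Lemma 21) and the
applications of §3 (Thm. 12: `Z(Σ_i Π_j f_j^{α_ij}) ≤ 4ktm + 4(e(1+t))^{mk²/2}`; Thm. 13;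
Cors. 14–15) are NOT in this file.

**Proofs** (the printed ones). Thm. 7: induction on `k`; `f_1 = W(f_1)` has no zero; divide by
`f_1`, differentiate (`(Σ a_i f_i/f_1)' = Σ_{i≥2} a_i (f_i/f_1)'`), Rolle with multiplicities
(`BD17.finite_zeros_and_rootCountMult_le_deriv_add_one`, Pólya–Szegő V 12), and Lemma 4 for the
prefix Wronskians of the new family (`BD17.wronskian_deriv_div_mul_pow`). Thm. 8: "`I ∖ Υ` is a
union of `|Υ| + 1` intervals"; on each of them Thm. 7 gives `≤ k − 1` zeros, plus at most `|Υ|`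
zeros on `Υ`: `(1+|Υ|)(k−1) + |Υ| = (1+|Υ|)k − 1` (`ncard_le_card_add_mul_of_components`, the
components being `J_c = {y ∈ I ∖ Υ : #{υ ∈ Υ : υ < y} = c}`, `c = 0, …, |Υ|`). When `Υ` is
infinite the right-hand sides are `⊤` and there is nothing to prove (the printed first case
"`Σ a_i f_i ≡ 0`" is subsumed). Lemma 5 (`⇐`, Bôcher): induction on `k` — where `f_0 ≠ 0`,
Lemma 4 and the induction hypothesis give constants `b_j` with `Σ_j b_j (f_{j+1}/f_0)' = 0`, so
`Σ_j b_j f_{j+1}/f_0` is a constant `c` (zero derivative on an interval) and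
`Σ_j b_j f_{j+1} − c f_0 = 0` there, whence on all of `Δ` by the identity principle.

Consumers / context: routes `Summits/ValiantsHypothesis/ValiantsHypothesis/Theses/RealTau.lean`
("the Voorhoeve–van der Poorten–KPT Wronskian inequality (KoiranPortierTavenas2015 Thm 9/12)"),
`LacunarySymmetroid.lean`, `SymmetroidDescartes.lean`, `KPlusLogSqLaw.lean` cite this paper's
Wronskian bounds as the known tool on the real side of the τ-conjecture; the sibling `AnswerNo.lean`
refutes the §6 question (Eq1 without the factor `k`). Cell `val-lit` (t14 g9, own pick;
LADDER-VALIANT V1 literature). Honest framing: a 2015 real-analysis lemma (building on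
Pólya–Szegő 1925 and Voorhoeve–van der Poorten 1975) becoming a theorem of the tree; nothing here
bears on VP versus VNP.

## References

* [KoiranPortierTavenas2015] P. Koiran, N. Portier, S. Tavenas, *A Wronskian approach to the real
  τ-conjecture*, J. Symbolic Comput. 68 (2015) 195–214, doi:10.1016/j.jsc.2014.09.036,
  arXiv:1205.1015 — §2: Lemmas 3–5, Def. 6, Thms. 7–9 (held text p0005).
* M. Bôcher, *The theory of linear dependence*, Ann. of Math. (2) 2 (1900/01) 81–96 (Lemma 5, as
  cited in print: "[Bo1900b]").
* [PolyaSzego1998] G. Pólya, G. Szegő, *Problems and Theorems in Analysis II*, Part V problems 12,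
  87–90, Part VII problems 57–58 (the tree's `BD17*` proof files).
-/

noncomputable section

open scoped Topology
open Set

namespace Literature.Computability.AlgebraicComplexity.KoiranPortierTavenas2015

/-! ### The two Wronskian vocabularies of the tree agree -/

/-- The sibling file's `wronskian f m` (`ℕ`-indexed family, prefix of length `m`) is BD 2017's
`BD17.wronskian` of the `Fin m`-indexed prefix (both are `det (f_c^{(r)}(y))_{r,c<m}`).
[cite: KoiranPortierTavenas2015, §2 (p0005:L3, definition of `W`)] -/
theorem wronskian_eq_bd17_wronskian (f : ℕ → ℝ → ℝ) (m : ℕ) (y : ℝ) :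
    wronskian f m y = BD17.wronskian (fun b : Fin m => f b) y := rfl

/-! ### Lemma 3 and Lemma 4 -/

/-- **KPT 2015, Lemma 3** (p0005:L11): "`W(gf_1, …, gf_k) = g^k W(f_1, …, f_k)`" — here at a
point `y` where `g, f_0, …, f_{k−1}` are real analytic (printed for `(k−1)`-times differentiable
functions; Pólya–Szegő VII 57, the tree's `BD17.wronskian_mul_left`).
-- TODO(general form): `(k−1)`-times differentiable functions.
[cite: KoiranPortierTavenas2015, Lemma 3] -/
theorem KPT2015_lemma_3_analytic (g : ℝ → ℝ) (f : ℕ → ℝ → ℝ) (k : ℕ) {y : ℝ} (hg : AnalyticAt ℝ g y)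
    (hf : ∀ i < k, AnalyticAt ℝ (f i) y) :
    wronskian (fun i z => g z * f i z) k y = g y ^ k * wronskian f k y := by
  rw [wronskian_eq_bd17_wronskian, wronskian_eq_bd17_wronskian]
  exact BD17.wronskian_mul_left g (fun b : Fin k => f b) hg (fun b => hf b b.isLt)

/-- **KPT 2015, Lemma 4** (p0005:L18): "over `I`, `W(f_1, …, f_k) = (f_1)^k W((f_2/f_1)', …,
(f_k/f_1)')`" — here with `k = ℓ + 1` real-analytic functions `f 0, …, f ℓ` on an open set `Δ` on
which `f 0` does not vanish (the paper assumes all `f_i` nonvanishing and `(k−1)`-times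
differentiable; Pólya–Szegő VII 58, the tree's `BD17.wronskian_deriv_div_mul_pow`).
-- TODO(general form): `(k−1)`-times differentiable functions.
[cite: KoiranPortierTavenas2015, Lemma 4] -/
theorem KPT2015_lemma_4_analytic (f : ℕ → ℝ → ℝ) (ℓ : ℕ) {Δ : Set ℝ} (hΔ : IsOpen Δ)
    (hf : ∀ i < ℓ + 1, AnalyticOnNhd ℝ (f i) Δ) (h0 : ∀ z ∈ Δ, f 0 z ≠ 0) {y : ℝ} (hy : y ∈ Δ) :
    wronskian f (ℓ + 1) y =
      f 0 y ^ (ℓ + 1) * wronskian (fun i z => deriv (fun w => f (i + 1) w / f 0 w) z) ℓ y := by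
  have key := BD17.wronskian_deriv_div_mul_pow (fun b : Fin (ℓ + 1) => f b) 0 Fin.succ hΔ
    (fun b => hf b b.isLt) h0 hy
  have hcons : (Fin.cons (f ((0 : Fin (ℓ + 1)) : ℕ))
      (fun b : Fin ℓ => f ((Fin.succ b : Fin (ℓ + 1)) : ℕ)) : Fin (ℓ + 1) → ℝ → ℝ) =
      fun b : Fin (ℓ + 1) => f b := by
    funext c
    refine Fin.cases ?_ (fun b => ?_) c
    · simp
    · simp
  rw [hcons] at key
  rw [wronskian_eq_bd17_wronskian, wronskian_eq_bd17_wronskian, ← key, mul_comm]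
  rfl

/-! ### Theorem 7 -/

/-- **KPT 2015, Theorem 7** (p0005:L36; "nearly implied by Voorhoeve's result"): if the prefix
Wronskians `W(f_0), W(f_0,f_1), …, W(f_0,…,f_{k−1})` have no zero on the open interval `Δ`, then for
coefficients `a_0, …, a_{k−1}` not all zero the combination `Σ_{i<k} a_i f_i` has finitely many
zeros in `Δ` and at most `k − 1` of them COUNTED WITH MULTIPLICITY (order of vanishing). ANALYTIC
SPECIAL CASE: typed for real-analytic `f_i` (the paper: `(k−1)`-times differentiable) on an open
interval (= open preconnected `Δ`; the paper: any interval). Printed proof followed: induction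
on `k`, division by `f_0 = W(f_0)`, Rolle with multiplicities (Pólya–Szegő V 12) and Lemma 4.
-- TODO(general form): `(k−1)`-times differentiable functions; non-open intervals.
[cite: KoiranPortierTavenas2015, Thm. 7] -/
theorem KPT2015_thm_7_analytic :
    ∀ (k : ℕ) (f : ℕ → ℝ → ℝ) (a : ℕ → ℝ) {Δ : Set ℝ}, IsOpen Δ → IsPreconnected Δ →
      (∀ i < k, AnalyticOnNhd ℝ (f i) Δ) →
      (∀ i, 1 ≤ i → i ≤ k → ∀ y ∈ Δ, wronskian f i y ≠ 0) →
      (∃ i < k, a i ≠ 0) →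
      {y | y ∈ Δ ∧ ∑ i ∈ Finset.range k, a i * f i y = 0}.Finite ∧
        BD17.rootCountMult (fun y => ∑ i ∈ Finset.range k, a i * f i y) Δ ≤ k - 1 := by
  intro k
  induction k with
  | zero =>
    intro f a Δ _ _ _ _ ha
    obtain ⟨i, hi, -⟩ := ha
    exact absurd hi (Nat.not_lt_zero i)
  | succ k IH =>
    intro f a Δ hΔ hΔc hf hW ha
    -- `f_0 = W(f_0)` has no zero on `Δ`
    have h0 : ∀ y ∈ Δ, f 0 y ≠ 0 := by
      intro y hy
      have h := hW 1 le_rfl (Nat.succ_le_succ (Nat.zero_le k)) y hy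
      rwa [wronskian_one_apply] at h
    by_cases hb : ∀ j < k, a (j + 1) = 0
    · -- "If a_2 = ⋯ = a_k = 0, then a_1 ≠ 0 and a_1 f_1 has no zero"
      have ha0 : a 0 ≠ 0 := by
        obtain ⟨i, hi, hai⟩ := ha
        cases i with
        | zero => exact hai
        | succ j => exact absurd (hb j (by omega)) hai
      apply BD17.finite_and_rootCountMult_le_of_forall_ne_zero
      intro y hy
      have htail : ∑ j ∈ Finset.range k, a (j + 1) * f (j + 1) y = 0 :=
        Finset.sum_eq_zero fun j hj => by rw [hb j (Finset.mem_range.mp hj), zero_mul]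
      change ∑ i ∈ Finset.range (k + 1), a i * f i y ≠ 0
      rw [Finset.sum_range_succ', htail, zero_add]
      exact mul_ne_zero ha0 (h0 y hy)
    · -- otherwise divide by `f_0`, differentiate, and apply the induction hypothesis
      push Not at hb
      obtain ⟨j₀, hj₀, hbj₀⟩ := hb
      set H : ℕ → ℝ → ℝ := fun j z => deriv (fun w => f (j + 1) w / f 0 w) z with hHdef
      set b : ℕ → ℝ := fun j => a (j + 1) with hbdef
      have hH_an : ∀ j < k, AnalyticOnNhd ℝ (H j) Δ := by
        intro j hj y hy
        exact ((hf (j + 1) (by omega) y hy).div (hf 0 (by omega) y hy) (h0 y hy)).deriv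
      -- Lemma 4: the prefix Wronskians of `H` do not vanish
      have hHW : ∀ i, 1 ≤ i → i ≤ k → ∀ y ∈ Δ, wronskian H i y ≠ 0 := by
        intro i _ hik y hy hzero
        have key := KPT2015_lemma_4_analytic f i hΔ (fun j hj => hf j (by omega)) h0 hy
        apply hW (i + 1) (by omega) (by omega) y hy
        rw [key]
        change f 0 y ^ (i + 1) * wronskian H i y = 0
        rw [hzero, mul_zero]
      obtain ⟨hfinH, hcountH⟩ := IH H b hΔ hΔc hH_an hHW ⟨j₀, hj₀, hbj₀⟩
      -- `G = (Σ a_i f_i)/f_0` and `G' = Σ_{j<k} b_j H_j` on `Δ`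
      set F : ℝ → ℝ := fun y => ∑ i ∈ Finset.range (k + 1), a i * f i y with hFdef
      set G : ℝ → ℝ := fun z => ∑ i ∈ Finset.range (k + 1), a i * (f i z / f 0 z) with hGdef
      have hGeq : G = fun z => (f 0 z)⁻¹ * F z := by
        funext z
        simp only [hGdef, hFdef, Finset.mul_sum]
        exact Finset.sum_congr rfl fun i _ => by rw [div_eq_mul_inv]; ring
      have hF_an : AnalyticOnNhd ℝ F Δ := by
        intro y hy
        simp only [hFdef]
        exact Finset.analyticAt_fun_sum _ fun i hi =>
          analyticAt_const.mul (hf i (Finset.mem_range.mp hi) y hy)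
      have hG_an : AnalyticOnNhd ℝ G Δ := by
        rw [hGeq]
        intro y hy
        exact ((hf 0 (by omega) y hy).inv (h0 y hy)).mul (hF_an y hy)
      have hderiv : Set.EqOn (deriv G) (fun z => ∑ j ∈ Finset.range k, b j * H j z) Δ := by
        intro y hy
        have hdiff : ∀ i, i < k + 1 → DifferentiableAt ℝ (fun z => f i z / f 0 z) y := fun i hi =>
          ((hf i hi y hy).div (hf 0 (by omega) y hy) (h0 y hy)).differentiableAt
        simp only [hGdef]
        rw [deriv_fun_sum (fun i hi => ((hdiff i (Finset.mem_range.mp hi)).const_mul (a i)))]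
        simp only [deriv_const_mul_field]
        rw [Finset.sum_range_succ']
        -- the term `i = 0`: `f_0/f_0 = 1` near `y`
        have hqq : deriv (fun z => f 0 z / f 0 z) y = 0 := by
          have hev : (fun z => f 0 z / f 0 z) =ᶠ[𝓝 y] fun _ => (1 : ℝ) := by
            filter_upwards [hΔ.mem_nhds hy] with z hz
            exact div_self (h0 z hz)
          rw [hev.deriv_eq, deriv_const]
        rw [hqq, mul_zero, add_zero]
      -- Rolle with multiplicities for `G`
      obtain ⟨hsetG', hcountG'⟩ := BD17.rootCountMult_congr_of_eqOn hΔ hderiv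
      have hfinG' : {y | y ∈ Δ ∧ deriv G y = 0}.Finite := by rw [hsetG']; exact hfinH
      obtain ⟨hfinG, hcountG⟩ :=
        BD17.finite_zeros_and_rootCountMult_le_deriv_add_one hΔ hΔc hG_an hfinG'
      obtain ⟨hsetF, hcountF⟩ := BD17.rootCountMult_mul_left_eq (f := F)
        (g := fun z => (f 0 z)⁻¹) hF_an (fun y hy => (hf 0 (by omega) y hy).inv (h0 y hy))
        (fun y hy => inv_ne_zero (h0 y hy))
      obtain ⟨hsetGF, hcountGF⟩ := BD17.rootCountMult_congr_of_eqOn hΔ (f := G)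
        (g := fun z => (f 0 z)⁻¹ * F z) (fun y _ => congrFun hGeq y)
      refine ⟨?_, ?_⟩
      · have : {y | y ∈ Δ ∧ F y = 0}.Finite := by rw [← hsetF, ← hsetGF]; exact hfinG
        simpa only [hFdef] using this
      · rw [← hcountF, ← hcountGF]
        calc BD17.rootCountMult G Δ ≤ BD17.rootCountMult (deriv G) Δ + 1 := hcountG
          _ = BD17.rootCountMult (fun z => ∑ j ∈ Finset.range k, b j * H j z) Δ + 1 := by
              rw [hcountG']
          _ ≤ (k - 1) + 1 := by omega
          _ = k + 1 - 1 := by omega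

/-! ### Distinct zeros versus zeros counted with multiplicity -/

/-- The number of DISTINCT zeros in an open set `Δ` of a function analytic on `Δ` with finitely many
zeros there is at most the number of zeros counted with multiplicity (each zero has order `≥ 1`).
[cite: KoiranPortierTavenas2015, Def. 6 (p0005:L29) with Thm. 7 ("counted with multiplicity")] -/
theorem ncard_zeros_le_rootCountMult {F : ℝ → ℝ} {Δ : Set ℝ} (hΔ : IsOpen Δ)
    (hF : AnalyticOnNhd ℝ F Δ) (hfin : {y | y ∈ Δ ∧ F y = 0}.Finite) :
    {y | y ∈ Δ ∧ F y = 0}.ncard ≤ BD17.rootCountMult F Δ := by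
  classical
  unfold BD17.rootCountMult
  rw [finsum_mem_eq_finite_toFinset_sum _ hfin, Set.ncard_eq_toFinset_card _ hfin,
    Finset.card_eq_sum_ones]
  refine Finset.sum_le_sum fun y hy => ?_
  rw [Set.Finite.mem_toFinset] at hy
  obtain ⟨hyΔ, hFy⟩ := hy
  have hne_top := BD17.analyticOrderAt_ne_top_of_finite_zeros hΔ hyΔ hfin
  have hne_zero : analyticOrderAt F y ≠ 0 := analyticOrderAt_ne_zero.mpr ⟨hF y hyΔ, hFy⟩
  have hcast : (analyticOrderNatAt F y : ℕ∞) = analyticOrderAt F y :=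
    Nat.cast_analyticOrderNatAt hne_top
  by_contra hlt
  have h0 : analyticOrderNatAt F y = 0 := by omega
  rw [h0, Nat.cast_zero] at hcast
  exact hne_zero hcast.symm

/-- **KPT 2015, Theorem 7 (analytic case), distinct zeros** (p0005:L36): under the hypotheses of
`KPT2015_thm_7_analytic`, `Σ_{i<k} a_i f_i` has at most `k − 1` distinct zeros in `Δ`.
[cite: KoiranPortierTavenas2015, Thm. 7] -/
theorem KPT2015_thm_7_analytic_ncard (k : ℕ) (f : ℕ → ℝ → ℝ) (a : ℕ → ℝ) {Δ : Set ℝ} (hΔ : IsOpen Δ)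
    (hΔc : IsPreconnected Δ) (hf : ∀ i < k, AnalyticOnNhd ℝ (f i) Δ)
    (hW : ∀ i, 1 ≤ i → i ≤ k → ∀ y ∈ Δ, wronskian f i y ≠ 0) (ha : ∃ i < k, a i ≠ 0) :
    {y | y ∈ Δ ∧ ∑ i ∈ Finset.range k, a i * f i y = 0}.Finite ∧
      {y | y ∈ Δ ∧ ∑ i ∈ Finset.range k, a i * f i y = 0}.ncard ≤ k - 1 := by
  obtain ⟨hfin, hcount⟩ := KPT2015_thm_7_analytic k f a hΔ hΔc hf hW ha
  have hF_an : AnalyticOnNhd ℝ (fun y => ∑ i ∈ Finset.range k, a i * f i y) Δ := by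
    intro y hy
    exact Finset.analyticAt_fun_sum _ fun i hi =>
      analyticAt_const.mul (hf i (Finset.mem_range.mp hi) y hy)
  exact ⟨hfin, (ncard_zeros_le_rootCountMult hΔ hF_an hfin).trans hcount⟩

/-- **KPT 2015, Theorem 7 on `I = ℝ`** (p0005:L36), in the sibling file's vocabulary: if
`f_0, …, f_{k−1}` are analytic on `ℝ` and none of the prefix Wronskians `W_1, …, W_k` has a real
zero, then `Z_ℝ(Σ_{i<k} a_i f_i) ≤ k − 1` for coefficients not all zero.
[cite: KoiranPortierTavenas2015, Thm. 7] -/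
theorem KPT2015_thm_7_analytic_real (k : ℕ) (f : ℕ → ℝ → ℝ) (a : ℕ → ℝ)
    (hf : ∀ i < k, ∀ x : ℝ, AnalyticAt ℝ (f i) x)
    (hW : ∀ i, 1 ≤ i → i ≤ k → ∀ x : ℝ, wronskian f i x ≠ 0) (ha : ∃ i < k, a i ≠ 0) :
    realZeros (fun x => ∑ i ∈ Finset.range k, a i * f i x) ≤ ((k - 1 : ℕ) : ℕ∞) := by
  obtain ⟨hfin, hcount⟩ := KPT2015_thm_7_analytic_ncard k f a isOpen_univ isPreconnected_univ
    (fun i hi x _ => hf i hi x) (fun i h1 h2 x _ => hW i h1 h2 x) ha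
  have hset : {x : ℝ | ∑ i ∈ Finset.range k, a i * f i x = 0} =
      {y | y ∈ (Set.univ : Set ℝ) ∧ ∑ i ∈ Finset.range k, a i * f i y = 0} := by
    ext x; simp
  unfold realZeros
  rw [hset, ← hfin.cast_ncard_eq]
  exact_mod_cast hcount


/-! ### Theorem 8: the components of `I ∖ Υ` -/

/-- The gluing step of the printed proof of Thm. 8 (p0005:L85–87): "The set `I ∖ Υ` is an union of
`|Υ| + 1` intervals. Let `J` be one of these intervals … at most `(1 + |Υ|)(k − 1)` zeros over
`I ∖ Υ` and at most `(1 + |Υ|)(k − 1) + |Υ|` zeros over `I`." Abstract form: if a set `S ⊆ Δ`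
(`Δ` an open interval) meets every open subinterval `J ⊆ Δ ∖ Υ` in finitely many, at most `N`,
points, then `S` is finite with `|S| ≤ |Υ| + (|Υ| + 1) N`. The subintervals used are the components
`J_c = {y ∈ Δ ∖ Υ : #{υ ∈ Υ : υ < y} = c}`, `c = 0, …, |Υ|`.
[cite: KoiranPortierTavenas2015, Thm. 8 (proof)] -/
theorem ncard_le_card_add_mul_of_components {Δ : Set ℝ} (hΔ : IsOpen Δ) (hΔc : IsPreconnected Δ)
    (Υ : Finset ℝ) {S : Set ℝ} (hS : S ⊆ Δ) (N : ℕ)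
    (hJ : ∀ J : Set ℝ, IsOpen J → IsPreconnected J → J ⊆ Δ → (∀ y ∈ J, y ∉ Υ) →
      (S ∩ J).Finite ∧ (S ∩ J).ncard ≤ N) :
    S.Finite ∧ S.ncard ≤ Υ.card + (Υ.card + 1) * N := by
  classical
  -- the counting function and the components `J_c`
  set cnt : ℝ → ℕ := fun y => (Υ.filter (fun u => u < y)).card with hcnt
  set J : ℕ → Set ℝ := fun c => {y | y ∈ Δ ∧ y ∉ Υ ∧ cnt y = c} with hJdef
  have hJΔ : ∀ c, J c ⊆ Δ := fun c y hy => hy.1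
  have hJΥ : ∀ c, ∀ y ∈ J c, y ∉ Υ := fun c y hy => hy.2.1
  -- `cnt` is monotone, and jumps at the points of `Υ`
  have hcnt_mono : ∀ {y y' : ℝ}, y ≤ y' → cnt y ≤ cnt y' := by
    intro y y' hyy'
    simp only [hcnt]
    exact Finset.card_le_card fun u hu => by
      rw [Finset.mem_filter] at hu ⊢
      exact ⟨hu.1, lt_of_lt_of_le hu.2 hyy'⟩
  have hcnt_lt : ∀ {z y' : ℝ}, z ∈ Υ → z < y' → cnt z < cnt y' := by
    intro z y' hz hzy'
    simp only [hcnt]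
    apply Finset.card_lt_card
    rw [Finset.ssubset_iff_of_subset (fun u hu => by
      rw [Finset.mem_filter] at hu ⊢
      exact ⟨hu.1, hu.2.trans hzy'⟩)]
    exact ⟨z, by simp [hz, hzy'], by simp⟩
  have hcnt_eq : ∀ {y y' : ℝ}, y ≤ y' → (∀ u ∈ Υ, ¬ (y ≤ u ∧ u < y')) → cnt y = cnt y' := by
    intro y y' hyy' hno
    simp only [hcnt]
    congr 1
    ext u
    simp only [Finset.mem_filter, and_congr_right_iff]
    intro hu
    constructor
    · intro h
      exact lt_of_lt_of_le h hyy'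
    · intro h
      by_contra hnot
      exact hno u hu ⟨not_lt.mp hnot, h⟩
  -- each `J_c` is an interval …
  have hJord : ∀ c, (J c).OrdConnected := by
    intro c
    refine Set.ordConnected_iff.mpr fun y₁ hy₁ y₂ hy₂ _ z hz => ?_
    have hzΔ : z ∈ Δ := hΔc.ordConnected.out hy₁.1 hy₂.1 hz
    have hc₁ : cnt y₁ ≤ cnt z := hcnt_mono hz.1
    have hc₂ : cnt z ≤ cnt y₂ := hcnt_mono hz.2
    rw [hy₁.2.2] at hc₁
    rw [hy₂.2.2] at hc₂
    have hzΥ : z ∉ Υ := by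
      intro hzΥ
      have hne : z ≠ y₂ := fun h => hy₂.2.1 (h ▸ hzΥ)
      have hlt := hcnt_lt hzΥ (lt_of_le_of_ne hz.2 hne)
      rw [hy₂.2.2] at hlt
      omega
    exact ⟨hzΔ, hzΥ, by omega⟩
  -- … and open
  have hJopen : ∀ c, IsOpen (J c) := by
    intro c
    rw [Metric.isOpen_iff]
    intro y₀ hy₀
    have hV : IsOpen (Δ \ (Υ : Set ℝ)) := hΔ.sdiff Υ.finite_toSet.isClosed
    obtain ⟨ε, hε, hball⟩ := Metric.isOpen_iff.mp hV y₀ ⟨hy₀.1, hy₀.2.1⟩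
    refine ⟨ε, hε, fun y hy => ?_⟩
    have hyV := hball hy
    refine ⟨hyV.1, hyV.2, ?_⟩
    -- no element of `Υ` lies between `y` and `y₀` (it would lie in the ball, inside `Δ ∖ Υ`)
    have hno : ∀ u ∈ Υ, ¬ (min y y₀ ≤ u ∧ u ≤ max y y₀) := by
      rintro u hu ⟨h1, h2⟩
      have huball : u ∈ Metric.ball y₀ ε := by
        rw [Real.ball_eq_Ioo] at hy ⊢
        constructor
        · calc y₀ - ε < min y y₀ := lt_min hy.1 (by linarith)
            _ ≤ u := h1
        · calc u ≤ max y y₀ := h2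
            _ < y₀ + ε := max_lt hy.2 (by linarith)
      exact (hball huball).2 hu
    rw [← hy₀.2.2]
    rcases le_total y y₀ with hle | hle
    · exact hcnt_eq hle fun u hu h => hno u hu
        ⟨by rw [min_eq_left hle]; exact h.1, by rw [max_eq_right hle]; exact h.2.le⟩
    · exact (hcnt_eq hle fun u hu h => hno u hu
        ⟨by rw [min_eq_right hle]; exact h.1, by rw [max_eq_left hle]; exact h.2.le⟩).symm
  -- every point of `S` lies on `Υ` or in some `J_c`, `c ≤ |Υ|`
  have hcover : S ⊆ (S ∩ (Υ : Set ℝ)) ∪ ⋃ c ∈ Finset.range (Υ.card + 1), (S ∩ J c) := by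
    intro y hy
    by_cases hyΥ : y ∈ Υ
    · exact Or.inl ⟨hy, hyΥ⟩
    · refine Or.inr ?_
      rw [Set.mem_iUnion₂]
      refine ⟨cnt y, Finset.mem_range.mpr (Nat.lt_succ_of_le ?_), hy, hS hy, hyΥ, rfl⟩
      exact Finset.card_filter_le _ _
  -- finiteness and the count
  have hfin_c : ∀ c, (S ∩ J c).Finite ∧ (S ∩ J c).ncard ≤ N := fun c =>
    hJ (J c) (hJopen c) (hJord c).isPreconnected (hJΔ c) (hJΥ c)
  have hfinΥ : (S ∩ (Υ : Set ℝ)).Finite := Υ.finite_toSet.subset Set.inter_subset_right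
  have hfinU : (⋃ c ∈ Finset.range (Υ.card + 1), (S ∩ J c)).Finite :=
    (Finset.range (Υ.card + 1)).finite_toSet.biUnion fun c _ => (hfin_c c).1
  have hSfin : S.Finite := (hfinΥ.union hfinU).subset hcover
  refine ⟨hSfin, ?_⟩
  calc S.ncard ≤ ((S ∩ (Υ : Set ℝ)) ∪ ⋃ c ∈ Finset.range (Υ.card + 1), (S ∩ J c)).ncard :=
        Set.ncard_le_ncard hcover (hfinΥ.union hfinU)
    _ ≤ (S ∩ (Υ : Set ℝ)).ncard + (⋃ c ∈ Finset.range (Υ.card + 1), (S ∩ J c)).ncard :=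
        Set.ncard_union_le _ _
    _ ≤ Υ.card + ∑ c ∈ Finset.range (Υ.card + 1), (S ∩ J c).ncard := by
        gcongr
        · calc (S ∩ (Υ : Set ℝ)).ncard ≤ (Υ : Set ℝ).ncard :=
              Set.ncard_le_ncard Set.inter_subset_right Υ.finite_toSet
            _ = Υ.card := Set.ncard_coe_finset Υ
        · exact Finset.set_ncard_biUnion_le _ _
    _ ≤ Υ.card + ∑ _c ∈ Finset.range (Υ.card + 1), N := by
        gcongr with c _
        exact (hfin_c c).2
    _ = Υ.card + (Υ.card + 1) * N := by
        rw [Finset.sum_const, Finset.card_range, smul_eq_mul]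

/-- **KPT 2015, Theorem 8 (Eq2), counting form** (p0005:L62): for `f_0, …, f_{k−1}` analytic on the
open interval `Δ` and coefficients not all zero, if the set `Υ` of zeros in `Δ` of the prefix
Wronskians `W_1, …, W_k` is finite, then `Σ_{i<k} a_i f_i` has finitely many zeros in `Δ`, and their
number `Z` satisfies `Z + 1 ≤ (1 + |Υ|) k` (i.e. `Z ≤ (1 + |Υ|)k − 1`). Printed proof followed:
`KPT2015_thm_7_analytic` on each of the `|Υ| + 1` components of `Δ ∖ Υ`
(`ncard_le_card_add_mul_of_components`). [cite: KoiranPortierTavenas2015, Thm. 8] -/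
theorem KPT2015_thm_8_ncard (k : ℕ) (f : ℕ → ℝ → ℝ) (a : ℕ → ℝ) {Δ : Set ℝ} (hΔ : IsOpen Δ)
    (hΔc : IsPreconnected Δ) (hf : ∀ i < k, AnalyticOnNhd ℝ (f i) Δ) (ha : ∃ i < k, a i ≠ 0)
    (hΥ : {y | y ∈ Δ ∧ ∃ i, 1 ≤ i ∧ i ≤ k ∧ wronskian f i y = 0}.Finite) :
    {y | y ∈ Δ ∧ ∑ i ∈ Finset.range k, a i * f i y = 0}.Finite ∧
      {y | y ∈ Δ ∧ ∑ i ∈ Finset.range k, a i * f i y = 0}.ncard + 1 ≤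
        (1 + hΥ.toFinset.card) * k := by
  classical
  obtain ⟨i₀, hi₀, -⟩ := id ha
  set S := {y | y ∈ Δ ∧ ∑ i ∈ Finset.range k, a i * f i y = 0} with hSdef
  have hS : S ⊆ Δ := fun y hy => hy.1
  obtain ⟨hSfin, hcount⟩ := ncard_le_card_add_mul_of_components hΔ hΔc hΥ.toFinset hS (k - 1)
    (fun J hJo hJc hJΔ hJΥ => by
      have hfJ : ∀ i < k, AnalyticOnNhd ℝ (f i) J := fun i hi y hy => hf i hi y (hJΔ hy)
      have hWJ : ∀ i, 1 ≤ i → i ≤ k → ∀ y ∈ J, wronskian f i y ≠ 0 := by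
        intro i h1 h2 y hy hzero
        apply hJΥ y hy
        rw [Set.Finite.mem_toFinset]
        exact ⟨hJΔ hy, i, h1, h2, hzero⟩
      obtain ⟨hfin, hle⟩ := KPT2015_thm_7_analytic_ncard k f a hJo hJc hfJ hWJ ha
      have hset : S ∩ J = {y | y ∈ J ∧ ∑ i ∈ Finset.range k, a i * f i y = 0} := by
        ext y
        constructor
        · rintro ⟨⟨-, hy⟩, hyJ⟩
          exact ⟨hyJ, hy⟩
        · rintro ⟨hyJ, hy⟩
          exact ⟨⟨hJΔ hyJ, hy⟩, hyJ⟩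
      rw [hset]
      exact ⟨hfin, hle⟩)
  refine ⟨hSfin, ?_⟩
  obtain ⟨k', rfl⟩ : ∃ k', k = k' + 1 := ⟨k - 1, by omega⟩
  rw [Nat.add_sub_cancel] at hcount
  calc S.ncard + 1 ≤ hΥ.toFinset.card + (hΥ.toFinset.card + 1) * k' + 1 :=
        Nat.add_le_add_right hcount 1
    _ = (1 + hΥ.toFinset.card) * (k' + 1) := by ring

/-- **KPT 2015, Theorem 8 (Eq2), subtraction-free form in `ℕ∞`** (p0005:L62):
`Z_Δ(Σ_{i<k} a_i f_i) + 1 ≤ (1 + |Υ|) · k`, where `Υ` is the set of zeros in `Δ` of the prefix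
Wronskians `W_1, …, W_k` and both counts are extended naturals (if `Υ` is infinite the right-hand
side is `⊤`). [cite: KoiranPortierTavenas2015, Thm. 8] -/
theorem KPT2015_thm_8_add_one_le (k : ℕ) (f : ℕ → ℝ → ℝ) (a : ℕ → ℝ) {Δ : Set ℝ}
    (hΔ : IsOpen Δ) (hΔc : IsPreconnected Δ) (hf : ∀ i < k, AnalyticOnNhd ℝ (f i) Δ)
    (ha : ∃ i < k, a i ≠ 0) :
    {y | y ∈ Δ ∧ ∑ i ∈ Finset.range k, a i * f i y = 0}.encard + 1 ≤
      (1 + {y | y ∈ Δ ∧ ∃ i, 1 ≤ i ∧ i ≤ k ∧ wronskian f i y = 0}.encard) * k := by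
  obtain ⟨i₀, hi₀, -⟩ := id ha
  have hk : (k : ℕ∞) ≠ 0 := by exact_mod_cast (show k ≠ 0 by omega)
  by_cases hΥ : {y | y ∈ Δ ∧ ∃ i, 1 ≤ i ∧ i ≤ k ∧ wronskian f i y = 0}.Finite
  · obtain ⟨hSfin, hle⟩ := KPT2015_thm_8_ncard k f a hΔ hΔc hf ha hΥ
    rw [← hSfin.cast_ncard_eq, hΥ.encard_eq_coe_toFinset_card]
    exact_mod_cast hle
  · rw [Set.Infinite.encard_eq hΥ, add_top, ENat.top_mul hk]
    exact le_top

/-- `x + 1 ≤ y` gives `x ≤ y − 1` in `ℕ∞` (truncated subtraction). [folklore] -/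
private theorem enat_le_sub_one_of_add_one_le {x y : ℕ∞} (h : x + 1 ≤ y) : x ≤ y - 1 :=
  ENat.le_sub_of_add_le_right ENat.one_ne_top h

/-- **KPT 2015, Theorem 8, (Eq2) as printed** (p0005:L62–71): "if
`Υ = {x ∈ I | ∃ i ≤ k, W(f_1,…,f_i)(x) = 0}` is finite, then `Z(a_1f_1+⋯+a_kf_k) ≤ (1 + |Υ|)k − 1`"
— for `f_0, …, f_{k−1}` analytic on the open interval `Δ` and coefficients not all zero; stated in
`ℕ∞` for every `Υ` (when `Υ` is infinite the right-hand side is `⊤`). SHARP UP TO THE FACTOR `k`: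
the bound `k − 1 + Σ_i Z(W_i)` (§6 open question; Tavenas 2014, 5.10) FAILS — see the sibling
`AnswerNo.lean`, `kpt_open_question_answer_is_no` (`¬ KPTWronskianBoundOnR`) and
`tavenasWronskianBound_false` (`¬ TavenasWronskianBound`); Thm. 25 (p0013) shows `(1+|Υ|)(k−1)`
zeros do occur.
-- TODO(general form): non-open intervals `I`.
[cite: KoiranPortierTavenas2015, Thm. 8] -/
theorem KPT2015_thm_8 (k : ℕ) (f : ℕ → ℝ → ℝ) (a : ℕ → ℝ) {Δ : Set ℝ}
    (hΔ : IsOpen Δ) (hΔc : IsPreconnected Δ) (hf : ∀ i < k, AnalyticOnNhd ℝ (f i) Δ)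
    (ha : ∃ i < k, a i ≠ 0) :
    {y | y ∈ Δ ∧ ∑ i ∈ Finset.range k, a i * f i y = 0}.encard ≤
      (1 + {y | y ∈ Δ ∧ ∃ i, 1 ≤ i ∧ i ≤ k ∧ wronskian f i y = 0}.encard) * k - 1 :=
  enat_le_sub_one_of_add_one_le (KPT2015_thm_8_add_one_le k f a hΔ hΔc hf ha)

/-- **KPT 2015, Theorem 8, (Eq1)** (p0005:L62–66): "`Z(a_1f_1+⋯+a_kf_k) ≤
(1 + Σ_{i=1}^k Z(W(f_1,…,f_i))) k − 1`" — from (Eq2) and `|Υ| ≤ Σ_i Z(W_i)` (p0005:L85).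
[cite: KoiranPortierTavenas2015, Thm. 8] -/
theorem KPT2015_thm_8_sum (k : ℕ) (f : ℕ → ℝ → ℝ) (a : ℕ → ℝ) {Δ : Set ℝ}
    (hΔ : IsOpen Δ) (hΔc : IsPreconnected Δ) (hf : ∀ i < k, AnalyticOnNhd ℝ (f i) Δ)
    (ha : ∃ i < k, a i ≠ 0) :
    {y | y ∈ Δ ∧ ∑ i ∈ Finset.range k, a i * f i y = 0}.encard ≤
      (1 + ∑ i ∈ Finset.Icc 1 k, {y | y ∈ Δ ∧ wronskian f i y = 0}.encard) * k - 1 := by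
  have h2 := KPT2015_thm_8 k f a hΔ hΔc hf ha
  have hU : {y | y ∈ Δ ∧ ∃ i, 1 ≤ i ∧ i ≤ k ∧ wronskian f i y = 0} =
      ⋃ i ∈ Finset.Icc 1 k, {y | y ∈ Δ ∧ wronskian f i y = 0} := by
    ext y
    simp only [Set.mem_setOf_eq, Set.mem_iUnion, Finset.mem_Icc, exists_prop]
    constructor
    · rintro ⟨hy, i, h1, h2', h0⟩
      exact ⟨i, ⟨h1, h2'⟩, hy, h0⟩
    · rintro ⟨i, ⟨h1, h2'⟩, hy, h0⟩
      exact ⟨hy, i, h1, h2', h0⟩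
  have hΥle : {y | y ∈ Δ ∧ ∃ i, 1 ≤ i ∧ i ≤ k ∧ wronskian f i y = 0}.encard ≤
      ∑ i ∈ Finset.Icc 1 k, {y | y ∈ Δ ∧ wronskian f i y = 0}.encard := by
    rw [hU]
    exact Finset.set_encard_biUnion_le _ _
  calc _ ≤ _ := h2
    _ ≤ (1 + ∑ i ∈ Finset.Icc 1 k, {y | y ∈ Δ ∧ wronskian f i y = 0}.encard) * k - 1 := by
        gcongr

/-- **KPT 2015, Theorem 8 on `I = ℝ`** (p0005:L62), in the sibling file's vocabulary: for
`f_0, …, f_{k−1}` analytic on `ℝ` and coefficients not all zero,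
`Z_ℝ(Σ_{i<k} a_i f_i) ≤ (1 + Σ_{m=1}^k Z_ℝ(W_m)) · k − 1` in `ℕ∞`. Compare the sibling file
`AnswerNo.lean`: the §6 question `KPTWronskianBoundOnR` asks for `k − 1 + Σ_m Z_ℝ(W_m)` instead
(no factor `k`) and is REFUTED there (`kpt_open_question_answer_is_no`; likewise
`tavenasWronskianBound_false` for Tavenas' formulation) — the present bound is what IS proved in
print. [cite: KoiranPortierTavenas2015, Thm. 8] -/
theorem KPT2015_thm_8_real (k : ℕ) (f : ℕ → ℝ → ℝ) (a : ℕ → ℝ)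
    (hf : ∀ i < k, ∀ x : ℝ, AnalyticAt ℝ (f i) x) (ha : ∃ i < k, a i ≠ 0) :
    realZeros (fun x => ∑ i ∈ Finset.range k, a i * f i x) ≤
      (1 + ∑ m ∈ Finset.Icc 1 k, realZeros (wronskian f m)) * k - 1 := by
  have h := KPT2015_thm_8_sum k f a isOpen_univ isPreconnected_univ
    (fun i hi x _ => hf i hi x) ha
  have hset : ∀ g : ℝ → ℝ, {y | y ∈ (Set.univ : Set ℝ) ∧ g y = 0} = {x | g x = 0} := by
    intro g
    ext x
    simp
  simp only [hset] at h
  exact h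


/-! ### Lemma 5 (Bôcher): for analytic functions, a linear relation ⟺ the Wronskian vanishes -/

/-- The easy half of Lemma 5 (p0005:L23–24: "the Wronskian of a linearly dependent family of
functions is identically zero — if a family is dependent then the family of the derivatives is
also dependent with the same coefficients"): a relation `Σ_{i<k} a_i f_i = 0` on the open set `Δ`
with coefficients not all zero forces `W(f_0, …, f_{k−1}) = 0` on `Δ` (the coefficient vector is a
kernel vector of the Wronskian matrix). [cite: KoiranPortierTavenas2015, Lemma 5] -/
theorem wronskian_eq_zero_of_linear_relation (k : ℕ) (f : ℕ → ℝ → ℝ) (a : ℕ → ℝ) {Δ : Set ℝ}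
    (hΔ : IsOpen Δ) (hf : ∀ i < k, AnalyticOnNhd ℝ (f i) Δ) (ha : ∃ i < k, a i ≠ 0)
    (hrel : ∀ y ∈ Δ, ∑ i ∈ Finset.range k, a i * f i y = 0) {y : ℝ} (hy : y ∈ Δ) :
    wronskian f k y = 0 := by
  classical
  obtain ⟨i₀, hi₀, hai₀⟩ := ha
  unfold wronskian
  rw [← Matrix.exists_mulVec_eq_zero_iff]
  refine ⟨fun c : Fin k => a c, ?_, ?_⟩
  · intro h0
    exact hai₀ (by simpa using congrFun h0 ⟨i₀, hi₀⟩)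
  · funext r
    simp only [Matrix.mulVec, dotProduct, Matrix.of_apply, Pi.zero_apply]
    -- all derivatives of the vanishing combination vanish at `y`
    have hzero : iteratedDeriv (r : ℕ) (fun z => ∑ i ∈ Finset.range k, a i * f i z) y = 0 := by
      have hev : (fun z => ∑ i ∈ Finset.range k, a i * f i z) =ᶠ[𝓝 y] fun _ => (0 : ℝ) :=
        Filter.eventually_of_mem (hΔ.mem_nhds hy) fun z hz => hrel z hz
      rw [hev.iteratedDeriv_eq, iteratedDeriv_const]
      simp
    have hlin : iteratedDeriv (r : ℕ) (fun z => ∑ i ∈ Finset.range k, a i * f i z) y =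
        ∑ i ∈ Finset.range k, a i * iteratedDeriv (r : ℕ) (f i) y := by
      rw [iteratedDeriv_fun_sum (f := fun i z => a i * f i z) (fun i hi =>
        (show AnalyticAt ℝ (fun z => a i * f i z) y from
          analyticAt_const.mul (hf i (Finset.mem_range.mp hi) y hy)).contDiffAt)]
      exact Finset.sum_congr rfl fun i _ => iteratedDeriv_const_mul_field (a i) (f i)
    have hfin : ∑ c : Fin k, iteratedDeriv (r : ℕ) (f c) y * a c =
        ∑ i ∈ Finset.range k, a i * iteratedDeriv (r : ℕ) (f i) y := by
      rw [Finset.sum_range (fun i => a i * iteratedDeriv (r : ℕ) (f i) y)]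
      exact Finset.sum_congr rfl fun c _ => mul_comm _ _
    rw [hfin, ← hlin]
    exact hzero

/-- **KPT 2015, Lemma 5 (Bôcher 1900)** (p0005:L26): "If `f_1, …, f_k` are analytic functions, then
`(f_i)` is linearly dependent if and only if `W(f_1, …, f_k) = 0`" — on an open interval `Δ`
(open and connected), "linearly dependent" meaning a relation `Σ_{i<k} a_i f_i = 0` on `Δ` with
real coefficients not all zero, and "`W = 0`" meaning `W(f_0, …, f_{k−1})(y) = 0` for every `y ∈ Δ`.
(The paper recalls that the converse fails without analyticity — Peano, Bôcher.) Proof: `⇒` is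
`wronskian_eq_zero_of_linear_relation`; `⇐` by induction on `k`: if `f_0 ≢ 0`, restrict to a
subinterval where `f_0 ≠ 0`, apply Lemma 4 and the induction hypothesis to the family
`((f_{i+1}/f_0)')_i`, integrate (`(Σ b_i f_{i+1}/f_0)' = 0` ⇒ constant), and extend the resulting
relation from the subinterval to `Δ` by the identity principle.
-- TODO(general form): non-open intervals.
[cite: KoiranPortierTavenas2015, Lemma 5] -/
theorem KPT2015_lemma_5 :
    ∀ (k : ℕ) (f : ℕ → ℝ → ℝ) {Δ : Set ℝ}, IsOpen Δ → IsConnected Δ →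
      (∀ i < k, AnalyticOnNhd ℝ (f i) Δ) →
      ((∃ a : ℕ → ℝ, (∃ i < k, a i ≠ 0) ∧ ∀ y ∈ Δ, ∑ i ∈ Finset.range k, a i * f i y = 0) ↔
        ∀ y ∈ Δ, wronskian f k y = 0) := by
  intro k
  induction k with
  | zero =>
    intro f Δ _ hΔc _
    constructor
    · rintro ⟨a, ⟨i, hi, -⟩, -⟩
      exact absurd hi (Nat.not_lt_zero i)
    · intro hW
      obtain ⟨y, hy⟩ := hΔc.nonempty
      have h := hW y hy
      rw [wronskian_eq_bd17_wronskian, BD17.wronskian_fin_zero] at h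
      exact absurd h one_ne_zero
  | succ k IH =>
    intro f Δ hΔ hΔc hf
    constructor
    · rintro ⟨a, ha, hrel⟩ y hy
      exact wronskian_eq_zero_of_linear_relation (k + 1) f a hΔ hf ha hrel hy
    · intro hW
      by_cases h0 : ∀ y ∈ Δ, f 0 y = 0
      · -- `f_0 ≡ 0`: the relation `1 · f_0 = 0`
        refine ⟨fun i => if i = 0 then 1 else 0, ⟨0, Nat.succ_pos k, by simp⟩, fun y hy => ?_⟩
        rw [Finset.sum_range_succ']
        simp [h0 y hy]
      · push Not at h0
        obtain ⟨y₀, hy₀Δ, hy₀⟩ := h0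
        -- an open interval `Δ' ∋ y₀` inside `Δ` on which `f_0 ≠ 0`
        have hU : IsOpen (Δ ∩ (f 0) ⁻¹' {0}ᶜ) :=
          (hf 0 (Nat.succ_pos k)).continuousOn.isOpen_inter_preimage hΔ isOpen_compl_singleton
        obtain ⟨ε, hε, hball⟩ := Metric.isOpen_iff.mp hU y₀ ⟨hy₀Δ, hy₀⟩
        set Δ' : Set ℝ := Metric.ball y₀ ε with hΔ'def
        have hΔ'Δ : Δ' ⊆ Δ := fun z hz => (hball hz).1
        have hΔ'0 : ∀ z ∈ Δ', f 0 z ≠ 0 := fun z hz => (hball hz).2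
        have hΔ'open : IsOpen Δ' := Metric.isOpen_ball
        have hΔ'conn : IsConnected Δ' := by
          rw [hΔ'def, Real.ball_eq_Ioo]
          exact isConnected_Ioo (by linarith)
        have hf' : ∀ i < k + 1, AnalyticOnNhd ℝ (f i) Δ' := fun i hi z hz => hf i hi z (hΔ'Δ hz)
        -- the family `H_j = (f_{j+1}/f_0)'` on `Δ'` has vanishing Wronskian (Lemma 4)
        set H : ℕ → ℝ → ℝ := fun j z => deriv (fun w => f (j + 1) w / f 0 w) z with hHdef
        have hH_an : ∀ j < k, AnalyticOnNhd ℝ (H j) Δ' := fun j hj z hz =>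
          ((hf' (j + 1) (by omega) z hz).div (hf' 0 (by omega) z hz) (hΔ'0 z hz)).deriv
        have hHW : ∀ z ∈ Δ', wronskian H k z = 0 := by
          intro z hz
          have key := KPT2015_lemma_4_analytic f k hΔ'open hf' hΔ'0 hz
          have hWz : wronskian f (k + 1) z = 0 := hW z (hΔ'Δ hz)
          rw [key] at hWz
          rcases mul_eq_zero.mp hWz with h | h
          · exact absurd ((pow_eq_zero_iff (Nat.succ_ne_zero k)).mp h) (hΔ'0 z hz)
          · exact h
        obtain ⟨b, ⟨j₀, hj₀, hbj₀⟩, hbrel⟩ := (IH H hΔ'open hΔ'conn hH_an).mpr hHW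
        -- `G = Σ_j b_j f_{j+1}/f_0` has zero derivative on `Δ'`, hence is a constant `c`
        set G : ℝ → ℝ := fun z => ∑ j ∈ Finset.range k, b j * (f (j + 1) z / f 0 z) with hGdef
        have hdiffq : ∀ z ∈ Δ', ∀ j ∈ Finset.range k,
            DifferentiableAt ℝ (fun w => b j * (f (j + 1) w / f 0 w)) z := by
          intro z hz j hj
          exact (((hf' (j + 1) (by have := Finset.mem_range.mp hj; omega) z hz).div
            (hf' 0 (by omega) z hz) (hΔ'0 z hz)).differentiableAt).const_mul (b j)
        have hGdiff : DifferentiableOn ℝ G Δ' := by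
          intro z hz
          apply DifferentiableAt.differentiableWithinAt
          simp only [hGdef]
          exact DifferentiableAt.fun_sum (hdiffq z hz)
        have hGderiv : Δ'.EqOn (deriv G) 0 := by
          intro z hz
          simp only [hGdef, Pi.zero_apply]
          rw [deriv_fun_sum (hdiffq z hz)]
          simp only [deriv_const_mul_field]
          exact hbrel z hz
        obtain ⟨c, hc⟩ :=
          hΔ'open.exists_is_const_of_deriv_eq_zero hΔ'conn.isPreconnected hGdiff hGderiv
        -- the relation `Σ_j b_j f_{j+1} − c f_0 = 0` on `Δ'`, extended to `Δ`
        set a : ℕ → ℝ := fun i => if i = 0 then -c else b (i - 1) with hadef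
        have ha : ∃ i < k + 1, a i ≠ 0 := ⟨j₀ + 1, by omega, by simpa [hadef] using hbj₀⟩
        set F : ℝ → ℝ := fun z => ∑ i ∈ Finset.range (k + 1), a i * f i z with hFdef
        have hF_an : AnalyticOnNhd ℝ F Δ := by
          intro y hy
          simp only [hFdef]
          exact Finset.analyticAt_fun_sum _ fun i hi =>
            analyticAt_const.mul (hf i (Finset.mem_range.mp hi) y hy)
        have hFΔ' : ∀ z ∈ Δ', F z = 0 := by
          intro z hz
          have hz0 : f 0 z ≠ 0 := hΔ'0 z hz
          have hF_expand : F z = (∑ j ∈ Finset.range k, b j * f (j + 1) z) + (-c) * f 0 z := by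
            simp only [hFdef]
            rw [Finset.sum_range_succ']
            congr 1
          have hG_expand : f 0 z * G z = ∑ j ∈ Finset.range k, b j * f (j + 1) z := by
            simp only [hGdef, Finset.mul_sum]
            refine Finset.sum_congr rfl fun j _ => ?_
            rw [mul_comm, mul_assoc, div_mul_cancel₀ _ hz0]
          rw [hF_expand, ← hG_expand, hc z hz]
          ring
        have hFev : F =ᶠ[𝓝 y₀] 0 :=
          Filter.eventually_of_mem (hΔ'open.mem_nhds (Metric.mem_ball_self hε))
            fun z hz => hFΔ' z hz
        have hFzero := hF_an.eqOn_zero_of_preconnected_of_eventuallyEq_zero hΔc.isPreconnected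
          hy₀Δ hFev
        exact ⟨a, ha, fun y hy => hFzero hy⟩

/-- **Lemma 5 on `I = ℝ`**: for `f_0, …, f_{k−1}` analytic on `ℝ`, a nontrivial real linear
relation `Σ_{i<k} a_i f_i = 0` holds identically if and only if the Wronskian
`wronskian f k = W(f_0, …, f_{k−1})` is the zero function.
[cite: KoiranPortierTavenas2015, Lemma 5] -/
theorem KPT2015_lemma_5_real (k : ℕ) (f : ℕ → ℝ → ℝ)
    (hf : ∀ i < k, ∀ x : ℝ, AnalyticAt ℝ (f i) x) :
    (∃ a : ℕ → ℝ, (∃ i < k, a i ≠ 0) ∧ (fun x => ∑ i ∈ Finset.range k, a i * f i x) = 0) ↔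
      wronskian f k = 0 := by
  have h := KPT2015_lemma_5 k f isOpen_univ isConnected_univ (fun i hi x _ => hf i hi x)
  constructor
  · rintro ⟨a, ha, hrel⟩
    funext y
    exact (h.mp ⟨a, ha, fun y _ => congrFun hrel y⟩) y (Set.mem_univ y)
  · intro hW
    obtain ⟨a, ha, hrel⟩ := h.mpr fun y _ => congrFun hW y
    exact ⟨a, ha, funext fun y => hrel y (Set.mem_univ y)⟩

end Literature.Computability.AlgebraicComplexity.KoiranPortierTavenas2015
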